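import Summits.HodgeConjecture.HodgeConjecture.Theses.NikulinTwinTransport

/-!
# `AllMultipliersGlue` for route NikulinTwinTransport

The all-multipliers crux `HodgeSimilitudeAlgebraic` (every rational Hodge similitude of positive
rational multiplier `r` between `H²` of projective K3 surfaces is algebraic), specialised to the
multiplier `r = 2`, is exactly the target `TwinSimilitudeAlgebraic` (`X = Sim₂(K3)`); the only
step is the cast `((2 : ℚ) : ℂ) = 2`.
-/

namespace Summit.HodgeConjecture.HodgeConjecture.Theorems

open Summit.HodgeConjecture.HodgeConjecture.Theses.NikulinTwinTransport

/-- The support glue `AllMultipliersGlue : HodgeSimilitudeAlgebraic → TwinSimilitudeAlgebraic`: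
specialise the all-multipliers hypothesis to `r = 2` and rewrite the cast `((2 : ℚ) : ℂ) = 2`. -/
theorem allMultipliersGlue_proof :
    Summit.HodgeConjecture.HodgeConjecture.Theses.NikulinTwinTransport.AllMultipliersGlue := by
  unfold AllMultipliersGlue
  intro h μ hμ S S' hS hS' p p' hp hp' ψ h₁ h₂ h₃
  have h2 : (0 : ℚ) < 2 := two_pos
  have key := h 2 h2 μ hμ S S' hS hS' p p' hp hp' ψ h₁ h₂
    (fun x y a hxy => by simpa using h₃ x y a hxy)
  exact key

end Summit.HodgeConjecture.HodgeConjecture.Theorems
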